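import Summits.Ventures.CertifiedArithmetic.LowPrec.SRNBitRuleBias
import Summits.Ventures.CertifiedArithmetic.LowPrec.SRThresholdsTable
import HarnessLib

/-!
# One bit below the threshold, every format: the laws at `−maxRat + q`, `−maxRat + q²`, `q·q`

HONEST FRAMING: certified error envelopes and provably optimal rounding/accumulation schemes for
low-precision formats under stated cost models; every table by two implementations; no hardware or
vendor claims.

File LXXXIX of the SR slice.  File LXXXVIII: every `N`-bit rule is biased at a state whose exact
up-probability is not an `N`-bit dyadic, and at a NEGATIVE state with `θ = 2^−(N+1)` rule `A` rounds
up with probability `2θ` while `B`, `C` never do.  Here, at format level (`emaxCode ≥ 3`,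
`topMan ≥ 1`; `dn_valueSet_negMax_add`: the lower candidate of `−maxRat + δ`, `0 < δ ≤ q`, over the
value set is `−maxRat`), the one-bit-short laws behind the columns of the threshold table:
* `valueSet_pair_one_bit_short` / `valueSet_pairTree_one_bit_short` (TREE): the pair / pair tree
  `−maxRat + q` with `emaxCode − 2` bits — exact mean `−maxRat + q`; rule `A` `−maxRat + 2q`; rules
  `B`, `C` `−maxRat`;
* `valueSet_ip1_one_bit_short` (IP1): start `−maxRat`, one exact product `q·q`, `emaxCode − 2 + j`
  bits — exact `−maxRat + q²`; `A` `−maxRat + 2q²`; `B`, `C` `−maxRat`;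
* `valueSet_ip2_one_bit_short` (IP2, tree part): a genuine length-two TWO-STAGE inner product from
  the zero start, exact products `−maxRat` (`= −maxRat·1`) and `q` (`= q·1`), `emaxCode − 2` bits —
  exact `−maxRat + q`; `A` `−maxRat + 2q`; `B`, `C` `−maxRat`: the threshold is attained by an
  actual inner product, not only by a one-step state;
* `valueSet_prod_one_bit_short` (PROD / IP2, product part): `q·q` with `j − 1` bits, as a step and
  as the length-one two-stage inner product from zero — exact `q²`; `A`, `C` `0` (never up;
  `dn_valueSet_small`); `B` `2q²` — by the nonnegative mirror `pUpQ_A/B/C_nonneg_half`,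
  `stepQ_ABC_id_nonneg_half` of LXXXVIII's negative-state lemmas.

CORRECTION OF WORDING (the theorems stand; their gloss does not).  Files LXXXII
(`valueSet_tree_budget_sharp`, `valueSet_ip_budget_sharp`: "rule `A` … never rounds up there"),
LXXXVI (`Thresholds`, conjuncts TREE and IP1: "rule `A` dead there") and LXXXVII
(`Thresholds.attained`) describe their true arithmetic conjunct `probAwayA (L−1) θ = 0` at the
NEGATIVE witnesses `−maxRat + q`, `−maxRat + q²` as rule `A` never rounding up.  At a negative state
the rule consumes the away-probability `1 − θ`, so the correct reading — proved here — is: rule `A`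
one bit short rounds UP with probability `2θ` (mean too high by `θ·gap` = `q`, resp. `q²`), and it
is rules `B` and `C` that never round up (mean too low by the same amount).  "Rule `A` dead" IS
correct at the positive witness `q·q` of the product law (LXXXIV) and at the positive FP4 kernel
witnesses of LXXVIII.  The thresholds, their attainment, and every number in the tables are
unaffected: one bit short the law is wrong under each of the three rules (LXXXVIII,
`stepQ_ABC_id_ne_of_not_dyadic`).
-/

namespace Summit.Ventures.CertifiedArithmetic.LowPrec.SR.LimitedBits

open Literature.ComputerArithmetic.P3109
open Literature.ComputerArithmetic.ConnollyHighamMary2021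
open Literature.ComputerArithmetic.FloatingPoint (Format MiniFloat)
open Literature.ComputerArithmetic.FloatingPoint.MiniFloat (valueSet valueSet_nonempty)
open Summit.Ventures.CertifiedArithmetic.LowPrec.SR
open Finset STree

/-! ### One bit short at a NONNEGATIVE state (mirror of LXXXVIII, item 2) -/

section GenericPos

variable {K : Type*} [Field K] [LinearOrder K] [IsStrictOrderedRing K] [FloorRing K]

/-- Rule `A`, `N` bits, nonnegative state with `θ = 2^−(N+1)`: never rounds up. -/
theorem pUpQ_A_nonneg_half {F : Finset K} {c : K} {N : ℕ} (hdn : 0 ≤ dn F c)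
    (hθ : pUp F c = 1 / 2 ^ (N + 1)) : pUpQ F (probAwayA N) c = 0 := by
  rw [pUpQ_of_dn_nonneg F _ hdn, hθ]
  exact probAwayA_eq_zero N (by positivity)
    (one_div_lt_one_div_of_lt (by positivity) (pow_lt_pow_right₀ (by norm_num) (by omega)))

/-- Rule `B`, `N` bits, nonnegative state with `θ = 2^−(N+1)`: rounds up with probability `2θ`
(the tie `½` rounds away). -/
theorem pUpQ_B_nonneg_half {F : Finset K} {c : K} {N : ℕ} (hdn : 0 ≤ dn F c)
    (hθ : pUp F c = 1 / 2 ^ (N + 1)) : pUpQ F (probAwayB N) c = 2 / 2 ^ (N + 1) := by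
  rw [pUpQ_of_dn_nonneg F _ hdn, hθ, probAwayB_half, pow_succ]; field_simp

/-- Rule `C`, `N` bits, nonnegative state with `θ = 2^−(N+1)`: never rounds up (the tie `½` goes
to the even `0`). -/
theorem pUpQ_C_nonneg_half {F : Finset K} {c : K} {N : ℕ} (hdn : 0 ≤ dn F c)
    (hθ : pUp F c = 1 / 2 ^ (N + 1)) : pUpQ F (probAwayC N) c = 0 := by
  rw [pUpQ_of_dn_nonneg F _ hdn, hθ]; exact probAwayC_eq_zero N (by positivity) le_rfl

/-- **One bit short at a nonnegative state, the three rules.** `θ = pUp F c = 2^−(N+1)`,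
`0 ≤ dn F c`: rules `A` and `C` return `⌊c̄⌋` surely, rule `B`'s mean is `c̄ + (c̄ − ⌊c̄⌋)`; the
exact-SR mean is `c̄` — the roles of `A` and `B` are swapped with respect to a negative state
(`stepQ_ABC_id_neg_half`). -/
theorem stepQ_ABC_id_nonneg_half {F : Finset K} {c : K} {N : ℕ} (hdn : 0 ≤ dn F c)
    (hθ : pUp F c = 1 / 2 ^ (N + 1)) :
    stepQ F (probAwayA N) c (fun t => t) = dn F c ∧
    stepQ F (probAwayB N) c (fun t => t) = clamp F c + (clamp F c - dn F c) ∧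
    stepQ F (probAwayC N) c (fun t => t) = dn F c := by
  have h0 : pUp F c ≠ 0 := by rw [hθ]; positivity
  refine ⟨stepQ_id_of_pUpQ_zero h0 (pUpQ_A_nonneg_half hdn hθ), stepQ_id_of_pUpQ_two_mul h0 ?_,
    stepQ_id_of_pUpQ_zero h0 (pUpQ_C_nonneg_half hdn hθ)⟩
  rw [pUpQ_B_nonneg_half hdn hθ, hθ]; ring

end GenericPos

/-! ### Format level: the lower candidate of `−maxRat + δ` and the one-bit-short laws -/

section Formats

/-- The lower SR candidate of `δ`, `0 < δ < quantum`, over the value set (format with a nonzero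
value) is `0` (the upper one is `quantum`; `pUp_valueSet_small`). -/
theorem dn_valueSet_small (φ : Format) (h1 : 1 ≤ φ.maxScaled) {δ : ℚ} (h0 : 0 < δ)
    (hδ : δ < φ.quantum) : dn (valueSet φ) δ = 0 := by
  have hq := φ.quantum_pos
  have hqm : φ.quantum ≤ φ.maxRat := by
    unfold Format.maxRat
    have : (1 : ℚ) ≤ φ.maxScaled := by exact_mod_cast h1
    nlinarith
  have hca : |δ| = δ := abs_of_pos h0
  have hcm : |δ| ≤ φ.maxRat := by rw [hca]; linarith
  have hin : InHull (valueSet φ) δ := (valueSet_inHull_iff φ _).mpr hcm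
  have hr0 : 0 ≤ |δ| / φ.quantum := div_nonneg (abs_nonneg _) hq.le
  have hr1 : |δ| / φ.quantum < 1 := by rw [hca, div_lt_one hq]; exact hδ
  have hle : |δ| / φ.quantum ≤ φ.maxScaled := le_trans hr1.le (by exact_mod_cast h1)
  have hfl : ⌊|δ| / φ.quantum⌋ = 0 := by
    rw [Int.floor_eq_iff]; push_cast; constructor <;> linarith
  have hs : φ.shift ⌊|δ| / φ.quantum⌋.toNat = 0 := by
    rw [hfl, Int.toNat_zero]; exact Format.shift_eq_zero_of_lt (by positivity)
  unfold dn
  rw [clamp_eq_self hin, MiniFloat.chm_roundDown_eq hcm, MiniFloat.toRat_roundDown,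
    if_neg (not_lt.mpr h0.le), Format.rdGrid_cast hr0 hle, hs, pow_zero, div_one, hfl]
  simp

/-- The lower SR candidate of `−maxRat + δ` (`0 < δ ≤ quantum`, `emaxCode ≥ 2`, `topMan ≥ 1`) over
the value set is `−maxRat` (the upper one is `−maxRat + 2^(emaxCode−1)·quantum`,
`pUp_valueSet_negMax_add`). -/
theorem dn_valueSet_negMax_add (φ : Format) (hE : 2 ≤ φ.emaxCode) (ht : 1 ≤ φ.topMan) {δ : ℚ}
    (h0 : 0 < δ) (hδ : δ ≤ φ.quantum) : dn (valueSet φ) (-φ.maxRat + δ) = -φ.maxRat := by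
  set L := φ.emaxCode - 1 with hL
  have hq := φ.quantum_pos
  have hL1 : 1 ≤ L := by omega
  have h2L : (2 : ℚ) ≤ 2 ^ L := by
    calc (2 : ℚ) = 2 ^ 1 := by norm_num
      _ ≤ 2 ^ L := pow_le_pow_right₀ (by norm_num) hL1
  have hms : φ.maxScaled = (2 ^ φ.manBits + φ.topMan) * 2 ^ L := Format.maxScaled_eq (by omega)
  have hA1 : (2 : ℚ) ≤ ((2 ^ φ.manBits + φ.topMan : ℕ) : ℚ) := by
    have : 2 ≤ 2 ^ φ.manBits + φ.topMan := by have := Nat.one_le_two_pow (n := φ.manBits); omega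
    exact_mod_cast this
  set A : ℕ := 2 ^ φ.manBits + φ.topMan with hA
  have hmr : φ.maxRat = (A : ℚ) * 2 ^ L * φ.quantum := by
    unfold Format.maxRat; rw [hms]; push_cast; ring
  have h4 : (4 : ℚ) ≤ (A : ℚ) * 2 ^ L := by nlinarith [hA1, h2L]
  have hc0 : -φ.maxRat + δ < 0 := by
    have : φ.quantum < (A : ℚ) * 2 ^ L * φ.quantum := by nlinarith [h4, hq]
    rw [hmr]; linarith
  have hca : |-φ.maxRat + δ| = φ.maxRat - δ := by rw [abs_of_neg hc0]; ring
  have hcm : |-φ.maxRat + δ| ≤ φ.maxRat := by rw [hca]; linarith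
  -- no clamping
  have hin : InHull (valueSet φ) (-φ.maxRat + δ) := (valueSet_inHull_iff φ _).mpr hcm
  -- the scaled magnitude `r = maxScaled − δ/quantum`, its floor and its binade
  have hr : |-φ.maxRat + δ| / φ.quantum = (A : ℚ) * 2 ^ L - δ / φ.quantum := by
    rw [hca, hmr]; field_simp
  have hdq0 : 0 < δ / φ.quantum := div_pos h0 hq
  have hdq1 : δ / φ.quantum ≤ 1 := (div_le_one hq).mpr hδ
  have hr0 : 0 ≤ |-φ.maxRat + δ| / φ.quantum := div_nonneg (abs_nonneg _) hq.le
  have hle : |-φ.maxRat + δ| / φ.quantum ≤ φ.maxScaled := by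
    rw [hr, hms]; push_cast; linarith
  have hms1 : 1 ≤ φ.maxScaled := by
    have : 0 < A * 2 ^ L := by positivity
    rw [hms]; omega
  have hfl : ⌊|-φ.maxRat + δ| / φ.quantum⌋ = ((φ.maxScaled - 1 : ℕ) : ℤ) := by
    rw [hr, Int.floor_eq_iff]
    have e : (((φ.maxScaled - 1 : ℕ) : ℤ) : ℚ) = (A : ℚ) * 2 ^ L - 1 := by
      have : ((φ.maxScaled - 1 : ℕ) : ℚ) = (φ.maxScaled : ℚ) - 1 := by
        rw [Nat.cast_sub hms1, Nat.cast_one]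
      rw [Int.cast_natCast, this, hms]; push_cast; ring
    rw [e]; constructor <;> linarith
  have hfn : ⌊|-φ.maxRat + δ| / φ.quantum⌋.toNat = φ.maxScaled - 1 := by
    rw [hfl, Int.toNat_natCast]
  have hs : φ.shift ⌊|-φ.maxRat + δ| / φ.quantum⌋.toNat = L := by
    rw [hfn]; exact Format.shift_maxScaled_sub_one hE ht
  -- the two candidates from the directed grid
  have hε0 : 0 < δ / φ.quantum / 2 ^ L := by positivity
  have hε1 : δ / φ.quantum / 2 ^ L < 1 := by
    rw [div_lt_one (by positivity)]; linarith
  have hceil : ⌈|-φ.maxRat + δ| / φ.quantum / 2 ^ L⌉ = (A : ℤ) := by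
    rw [hr, Int.ceil_eq_iff]; push_cast
    constructor
    · have : ((A : ℚ) * 2 ^ L - δ / φ.quantum) / 2 ^ L = A - δ / φ.quantum / 2 ^ L := by
        field_simp
      rw [this]; linarith
    · rw [div_le_iff₀ (by positivity)]; nlinarith
  unfold dn
  rw [clamp_eq_self hin, MiniFloat.chm_roundDown_eq hcm, MiniFloat.toRat_roundDown, if_pos hc0,
    Format.ruGrid_cast hr0 hle, hs, hceil, hmr]
  push_cast; ring

/-- **The pair `−maxRat + q`, one bit short (`emaxCode − 2` bits), every format** (`emaxCode ≥ 3`,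
`topMan ≥ 1`): exact-SR mean `−maxRat + q`; rule `A` `−maxRat + 2q` (it rounds up with probability
`2^−(emaxCode−2)`, twice the exact `2^−(emaxCode−1)`); rules `B` and `C` `−maxRat` (never up). -/
theorem valueSet_pair_one_bit_short (φ : Format) (hE : 3 ≤ φ.emaxCode) (ht : 1 ≤ φ.topMan) :
    step (valueSet φ) (-φ.maxRat + φ.quantum) (fun t => t) = -φ.maxRat + φ.quantum ∧
    stepQ (valueSet φ) (probAwayA (φ.emaxCode - 2)) (-φ.maxRat + φ.quantum) (fun t => t)
      = -φ.maxRat + 2 * φ.quantum ∧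
    stepQ (valueSet φ) (probAwayB (φ.emaxCode - 2)) (-φ.maxRat + φ.quantum) (fun t => t)
      = -φ.maxRat ∧
    stepQ (valueSet φ) (probAwayC (φ.emaxCode - 2)) (-φ.maxRat + φ.quantum) (fun t => t)
      = -φ.maxRat := by
  have hq := φ.quantum_pos
  obtain ⟨⟨hm, hqm⟩, hv, -, -, -⟩ := valueSet_tree_budget_sharp φ (by omega) ht
  have hθ : pUp (valueSet φ) (-φ.maxRat + φ.quantum) = 1 / 2 ^ (φ.emaxCode - 2 + 1) := by
    rw [hv, show φ.emaxCode - 2 + 1 = φ.emaxCode - 1 by omega]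
  have hdn := dn_valueSet_negMax_add φ (by omega) ht hq le_rfl
  have hM0 : 0 < φ.maxRat := by
    have hms1 : 1 ≤ φ.maxScaled := by
      have : 0 < (2 ^ φ.manBits + φ.topMan) * 2 ^ (φ.emaxCode - 1) := by positivity
      rw [Format.maxScaled_eq (by omega)]; omega
    have h1 : (1 : ℚ) ≤ φ.maxScaled := by exact_mod_cast hms1
    unfold Format.maxRat; nlinarith
  have hdn0 : dn (valueSet φ) (-φ.maxRat + φ.quantum) < 0 := by rw [hdn]; linarith
  have hin : InHull (valueSet φ) (-φ.maxRat + φ.quantum) :=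
    ⟨⟨_, hm, by linarith⟩, ⟨_, hqm, by linarith⟩⟩
  have hcl := clamp_eq_self hin
  obtain ⟨hA, hB, hC⟩ := stepQ_ABC_id_neg_half (by omega) hdn0 hθ
  refine ⟨by rw [step_id, hcl], ?_, ?_, ?_⟩
  · rw [hA, hcl, hdn]; ring
  · rw [hB, hdn]
  · rw [hC, hdn]

/-- The same for the pair TREE `node (leaf (−maxRat)) (leaf q)` under `treeExpQ` / `treeExp`. -/
theorem valueSet_pairTree_one_bit_short (φ : Format) (hE : 3 ≤ φ.emaxCode) (ht : 1 ≤ φ.topMan) :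
    treeExp (valueSet φ) (node (leaf (-φ.maxRat)) (leaf φ.quantum)) (fun t => t)
      = -φ.maxRat + φ.quantum ∧
    treeExpQ (valueSet φ) (probAwayA (φ.emaxCode - 2))
      (node (leaf (-φ.maxRat)) (leaf φ.quantum)) (fun t => t) = -φ.maxRat + 2 * φ.quantum ∧
    treeExpQ (valueSet φ) (probAwayB (φ.emaxCode - 2))
      (node (leaf (-φ.maxRat)) (leaf φ.quantum)) (fun t => t) = -φ.maxRat ∧
    treeExpQ (valueSet φ) (probAwayC (φ.emaxCode - 2))
      (node (leaf (-φ.maxRat)) (leaf φ.quantum)) (fun t => t) = -φ.maxRat :=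
  valueSet_pair_one_bit_short φ hE ht

/-- **One-stage inner product, one bit short, every format** (`emaxCode ≥ 3`, `topMan ≥ 1`,
`bias + m ≥ 1`, `j = bias + m − 1`): from the format start `−maxRat`, accumulating the one exact
product `q·q` with `emaxCode − 2 + j` bits: exact mean `−maxRat + q²`; rule `A` `−maxRat + 2q²`;
rules `B`, `C` `−maxRat`. -/
theorem valueSet_ip1_one_bit_short (φ : Format) (hE : 3 ≤ φ.emaxCode) (ht : 1 ≤ φ.topMan)
    (h1 : 1 ≤ φ.bias + φ.manBits) :
    accExp (valueSet φ) (fun _ => φ.quantum * φ.quantum) 1 (fun t => t) (-φ.maxRat)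
      = -φ.maxRat + φ.quantum * φ.quantum ∧
    accExpQ (valueSet φ) (probAwayA (φ.emaxCode - 2 + (φ.bias + φ.manBits - 1)))
      (fun _ => φ.quantum * φ.quantum) 1 (fun t => t) (-φ.maxRat)
      = -φ.maxRat + 2 * (φ.quantum * φ.quantum) ∧
    accExpQ (valueSet φ) (probAwayB (φ.emaxCode - 2 + (φ.bias + φ.manBits - 1)))
      (fun _ => φ.quantum * φ.quantum) 1 (fun t => t) (-φ.maxRat) = -φ.maxRat ∧
    accExpQ (valueSet φ) (probAwayC (φ.emaxCode - 2 + (φ.bias + φ.manBits - 1)))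
      (fun _ => φ.quantum * φ.quantum) 1 (fun t => t) (-φ.maxRat) = -φ.maxRat := by
  have hq := φ.quantum_pos
  have hqj := Format.quantum_eq_inv_two_pow h1
  have hq1 : φ.quantum ≤ 1 := by
    rw [hqj, div_le_one (by positivity)]; exact one_le_pow₀ (by norm_num)
  have hqq : φ.quantum * φ.quantum ≤ φ.quantum := by nlinarith
  have hqq0 : 0 < φ.quantum * φ.quantum := by positivity
  obtain ⟨⟨hm, hqm⟩, hv, -, -, -⟩ := valueSet_ip_budget_sharp φ (by omega) ht h1
  set c := -φ.maxRat + φ.quantum * φ.quantum with hc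
  have hθ : pUp (valueSet φ) c = 1 / 2 ^ (φ.emaxCode - 2 + (φ.bias + φ.manBits - 1) + 1) := by
    rw [hv, show φ.emaxCode - 2 + (φ.bias + φ.manBits - 1) + 1
      = φ.emaxCode - 1 + (φ.bias + φ.manBits - 1) by omega]
  have hdn : dn (valueSet φ) c = -φ.maxRat := dn_valueSet_negMax_add φ (by omega) ht hqq0 hqq
  have hM0 : 0 < φ.maxRat := by
    have hms1 : 1 ≤ φ.maxScaled := by
      have : 0 < (2 ^ φ.manBits + φ.topMan) * 2 ^ (φ.emaxCode - 1) := by positivity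
      rw [Format.maxScaled_eq (by omega)]; omega
    have h1' : (1 : ℚ) ≤ φ.maxScaled := by exact_mod_cast hms1
    unfold Format.maxRat; nlinarith
  have hdn0 : dn (valueSet φ) c < 0 := by rw [hdn]; linarith
  have hin : InHull (valueSet φ) c :=
    ⟨⟨_, hm, by rw [hc]; linarith⟩, ⟨_, hqm, by rw [hc]; linarith⟩⟩
  have hcl := clamp_eq_self hin
  obtain ⟨hA, hB, hC⟩ := stepQ_ABC_id_neg_half (by omega) hdn0 hθ
  refine ⟨?_, ?_, ?_, ?_⟩
  · show step (valueSet φ) c (fun t => t) = _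
    rw [step_id, hcl]
  · show stepQ (valueSet φ) _ c (fun t => t) = _
    rw [hA, hcl, hdn, hc]; ring
  · show stepQ (valueSet φ) _ c (fun t => t) = _
    rw [hB, hdn]
  · show stepQ (valueSet φ) _ c (fun t => t) = _
    rw [hC, hdn]

/-- **Two-stage inner product, one bit short, every format** (`emaxCode ≥ 3`, `topMan ≥ 1`): the
length-two inner product from the zero start with exact products `−maxRat` (`= −maxRat · 1`) and
`q` (`= q · 1`), each first SR-rounded into the format (exactly: both are values) and then
SR-accumulated, under `emaxCode − 2` bits: exact two-stage mean `−maxRat + q`; rule `A`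
`−maxRat + 2q`; rules `B`, `C` `−maxRat`.  The TREE part `L = emaxCode − 1` of the two-stage
threshold (`valueSet_ip2_exact`, column IP2) is attained by an actual inner product. -/
theorem valueSet_ip2_one_bit_short (φ : Format) (hE : 3 ≤ φ.emaxCode) (ht : 1 ≤ φ.topMan) :
    ipExp (valueSet φ) (fun k => if k = 0 then -φ.maxRat else φ.quantum) 2 (fun t => t) 0
      = -φ.maxRat + φ.quantum ∧
    ipExpQ (valueSet φ) (probAwayA (φ.emaxCode - 2))
      (fun k => if k = 0 then -φ.maxRat else φ.quantum) 2 (fun t => t) 0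
      = -φ.maxRat + 2 * φ.quantum ∧
    ipExpQ (valueSet φ) (probAwayB (φ.emaxCode - 2))
      (fun k => if k = 0 then -φ.maxRat else φ.quantum) 2 (fun t => t) 0 = -φ.maxRat ∧
    ipExpQ (valueSet φ) (probAwayC (φ.emaxCode - 2))
      (fun k => if k = 0 then -φ.maxRat else φ.quantum) 2 (fun t => t) 0 = -φ.maxRat := by
  obtain ⟨⟨hm, hqm⟩, -⟩ := valueSet_tree_budget_sharp φ (by omega) ht
  obtain ⟨h0, hA, hB, hC⟩ := valueSet_pair_one_bit_short φ hE ht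
  have key : ∀ qr : ℚ → ℚ,
      ipExpQ (valueSet φ) qr (fun k => if k = 0 then -φ.maxRat else φ.quantum) 2 (fun t => t) 0
        = stepQ (valueSet φ) qr (-φ.maxRat + φ.quantum) (fun t => t) := by
    intro qr
    simp only [ipExpQ, ipStepQ, zero_add, Nat.add_one_ne_zero, stepQ_of_mem qr hm,
      stepQ_of_mem qr hqm, ↓reduceIte]
  have key0 : ipExp (valueSet φ) (fun k => if k = 0 then -φ.maxRat else φ.quantum) 2 (fun t => t) 0
      = step (valueSet φ) (-φ.maxRat + φ.quantum) (fun t => t) := by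
    simp only [ipExp, ipStep, zero_add, Nat.add_one_ne_zero, step_of_mem hm, step_of_mem hqm,
      ↓reduceIte]
  exact ⟨key0.trans h0, (key _).trans hA, (key _).trans hB, (key _).trans hC⟩

/-- **The product rounding one bit short, every format** (`1 ≤ maxScaled`, `bias + m ≥ 3`,
`j = bias + m − 1`): the exact product `q·q` of the format value `q` with itself (candidates `0` and
`q`, `θ = 2^−j`, `valueSet_prod_law_sharp`) has exact-SR mean `q·q`; under `j − 1` bits its mean is
`0` under rules `A` and `C` (never up) and `2·q·q` under rule `B` (up twice too often) — as a
one-step state and as the length-one TWO-STAGE inner product from the zero start (`ipExp = q·q`,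
`ipExpQ = 0, 2q·q, 0`).  At this POSITIVE witness "rule `A` dead" is the correct reading. -/
theorem valueSet_prod_one_bit_short (φ : Format) (h1 : 1 ≤ φ.maxScaled)
    (hj : 3 ≤ φ.bias + φ.manBits) :
    (stepQ (valueSet φ) (probAwayA (φ.bias + φ.manBits - 2)) (φ.quantum * φ.quantum) (fun t => t)
        = 0 ∧
      stepQ (valueSet φ) (probAwayB (φ.bias + φ.manBits - 2)) (φ.quantum * φ.quantum) (fun t => t)
        = 2 * (φ.quantum * φ.quantum) ∧
      stepQ (valueSet φ) (probAwayC (φ.bias + φ.manBits - 2)) (φ.quantum * φ.quantum) (fun t => t)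
        = 0) ∧
    ipExp (valueSet φ) (fun _ => φ.quantum * φ.quantum) 1 (fun t => t) 0 = φ.quantum * φ.quantum ∧
    ipExpQ (valueSet φ) (probAwayA (φ.bias + φ.manBits - 2)) (fun _ => φ.quantum * φ.quantum) 1
        (fun t => t) 0 = 0 ∧
    ipExpQ (valueSet φ) (probAwayB (φ.bias + φ.manBits - 2)) (fun _ => φ.quantum * φ.quantum) 1
        (fun t => t) 0 = 2 * (φ.quantum * φ.quantum) ∧
    ipExpQ (valueSet φ) (probAwayC (φ.bias + φ.manBits - 2)) (fun _ => φ.quantum * φ.quantum) 1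
        (fun t => t) 0 = 0 := by
  have hq := φ.quantum_pos
  have hne := valueSet_nonempty φ
  obtain ⟨hqm, hv, -, -, -⟩ := valueSet_prod_law_sharp φ h1 hj
  have hqj := Format.quantum_eq_inv_two_pow (by omega : 1 ≤ φ.bias + φ.manBits)
  have hq1 : φ.quantum < 1 := by
    rw [hqj, div_lt_one (by positivity)]
    exact one_lt_pow₀ (by norm_num) (by omega)
  have hqq : φ.quantum * φ.quantum < φ.quantum := by nlinarith
  have hM : 0 ≤ φ.maxRat := by unfold Format.maxRat; positivity
  have hin : InHull (valueSet φ) (φ.quantum * φ.quantum) :=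
    ⟨⟨_, MiniFloat.neg_maxRat_mem_valueSet φ, by nlinarith⟩, ⟨_, hqm, hqq.le⟩⟩
  have hcl := clamp_eq_self hin
  have hdn : dn (valueSet φ) (φ.quantum * φ.quantum) = 0 :=
    dn_valueSet_small φ h1 (by positivity) hqq
  have e : φ.bias + φ.manBits - 2 + 1 = φ.bias + φ.manBits - 1 := by omega
  have hθ : pUp (valueSet φ) (φ.quantum * φ.quantum) = 1 / 2 ^ (φ.bias + φ.manBits - 2 + 1) := by
    rw [e]; exact hv
  obtain ⟨hA, hB, hC⟩ := stepQ_ABC_id_nonneg_half (F := valueSet φ)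
    (N := φ.bias + φ.manBits - 2) (c := φ.quantum * φ.quantum) (le_of_eq hdn.symm) hθ
  rw [hdn] at hA hC; rw [hcl, hdn, sub_zero, ← two_mul] at hB
  have key : ∀ qr : ℚ → ℚ, ipExpQ (valueSet φ) qr (fun _ => φ.quantum * φ.quantum) 1 (fun t => t) 0
      = stepQ (valueSet φ) qr (φ.quantum * φ.quantum) (fun t => t) := by
    intro qr
    simp only [ipExpQ, ipStepQ]
    exact stepQ_congr_mem hne qr _ (fun a ha => by rw [zero_add, stepQ_of_mem qr ha])
  have key0 : ipExp (valueSet φ) (fun _ => φ.quantum * φ.quantum) 1 (fun t => t) 0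
      = φ.quantum * φ.quantum := by
    simp only [ipExp, ipStep]
    rw [step_congr (valueSet φ) (φ.quantum * φ.quantum)
        (f := fun a => step (valueSet φ) (0 + a) fun t => t) (g := fun t => t)
        (by simp only [zero_add, step_of_mem (up_mem hne _)])
        (by simp only [zero_add, step_of_mem (dn_mem hne _)]),
      step_id, hcl]
  refine ⟨⟨hA, hB, hC⟩, key0, ?_, ?_, ?_⟩
  · rw [key]; exact hA
  · rw [key]; exact hB
  · rw [key]; exact hC

end Formats

end Summit.Ventures.CertifiedArithmetic.LowPrec.SR.LimitedBits
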